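import Summits.AnomalousDissipation.AnomalousDissipation.Theses.DopplerClock
import Summits.AnomalousDissipation.AnomalousDissipation.Theorems.DopplerClockDopplerWorkIdentity
import Summits.AnomalousDissipation.AnomalousDissipation.Theorems.DopplerClockCruxesGiveTarget
import Summits.AnomalousDissipation.AnomalousDissipation.Theorems.DopplerClockQuadratureStressFloorPeriodicDriftBookkeeping

/-!
# Route DopplerClock (AnomalousDissipation) — crux `QuadratureStressFloor` (stmt-AnomalousDissipation-18129),
# line `laminar-burst-shadowing` (payload slug `Sketch`): the PERIODIC-WITNESS BRIDGE

`stub_bridgePeriodicWitnesses : LoudPeriodicDriftWitnesses → QuadratureStressFloor` — the composition of the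
line, landed as a tree theorem so that the crux closes by modus ponens the moment its one open stub (loud
time-periodic classical drift witnesses, `stub_loudBurstingPeriodicWitnesses` of `Lines/Sketch.lean`) is supplied.

**Hypothesis (stated inline, the registered core stub verbatim).** For some design `(F, V, m, n)` there are
`ν_j → 0⁺`, periods `τ_j > 0` and `τ_j`-periodic global classical solutions `(u_j, p_j)` of `NS_{ν_j}` on `T³`
forced by `f = F sin(2πm x₁) cos(2πn x₂) e₀`, with momentum `∫ u_j(0) = V e₂`, ν-uniform mean energy
`⟨‖u_j‖₂²⟩ ≤ E` and a ν-uniform mean dissipation floor `ε ≤ ⟨ν_j‖∇u_j‖₂²⟩`.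

**Conclusion.** The crux `QuadratureStressFloor` BY NAME: one Banach mean `Λ`, a no-leak drift-`V` Leray–Hopf
family of this force with per-`j` energy bounds and the quadrature stress floor `ε₀ ≤ −Λ⟨T_s(w_j)⟩`.

**Proof.** Periodic bookkeeping (`stub_periodicDriftBookkeeping`, landed): each `u_j` is global Leray–Hopf
from `u_j 0`, has a sup-in-time energy bound, satisfies no-leak with equality, and `Λ⟨(f,u_j)⟩ =
meanDissipation ≥ ε` for EVERY generalized limit `Λ` (fix one by `GeneralizedLimit.nonempty_holds`). The landed
two-mode identity (`dopplerWorkIdentity_proof`, item 18133) reads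
`−Λ⟨T_s(w_j)⟩ = (2πnV/F)·Λ⟨(f,u_j)⟩ − ν_j κ² Λ⟨(Ψ_s,u_j)⟩`, `κ² = 4π²(m²+n²)`; the quadrature pairing is
bounded uniformly, `|Λ⟨(Ψ_s,u_j)⟩| ≤ M` (`dopplerClock_abs_longTimeAvg_inner_le` under the uniform mean
energy); hence `−Λ⟨T_s(w_j)⟩ ≥ (2πnV/F)ε − ν_jκ²M ≥ (2πnV/F)ε/2 =: ε₀` as soon as `ν_j(κ²M + 1) ≤ (2πnV/F)ε/2`,
i.e. along the reindexed tail `j ↦ j + J` (Doering–Foias 2002, §2; Foias–Manley–Rosa–Temam 2001, Ch. IV §1).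

No new definitions. The theorem is CONDITIONAL on its inline hypothesis (an open, zeroth-law-grade existence
statement); it credits nothing by itself and is recorded on the crux item as the registered stub
`stub_bridgePeriodicWitnesses` of the line.
-/

noncomputable section

-- `Summit.<Summit>.<Problem>` is the tree's mandated summit-side namespace (CONVENTIONS §2); for this
-- single-conjunct summit the two coincide, so the duplicate is deliberate.
set_option linter.dupNamespace false

open MeasureTheory Set Filter Topology
open scoped InnerProductSpace RealInnerProductSpace

namespace Summit.AnomalousDissipation.AnomalousDissipation.Theorems

open Literature.Analysis.FluidPDE Literature.Analysis.FluidPDE.Torus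
open Literature.Analysis.FunctionSpaces Literature.Analysis.FunctionSpaces.Torus

/-- **Tail arithmetic of the periodic bridge.** If `-T = c * P - ν κ B` with `c > 0`, `ε ≤ P`, `|B| ≤ M`,
`0 ≤ ν`, `0 ≤ κ` and `ν * (κ * M) ≤ c * ε / 2`, then `c * ε / 2 ≤ -T`. [folklore] -/
theorem periodicBridge_floor_tail_arith {c ν κ M ε B T P : ℝ} (hc : 0 < c)
    (hid : -T = c * P - ν * κ * B) (hP : ε ≤ P) (hB : |B| ≤ M) (hν : 0 ≤ ν) (hκ : 0 ≤ κ)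
    (hsmall : ν * (κ * M) ≤ c * ε / 2) : c * ε / 2 ≤ -T := by
  rw [hid]
  have h1 : B ≤ M := (abs_le.1 hB).2
  have h2 : ν * κ * B ≤ ν * κ * M := mul_le_mul_of_nonneg_left h1 (mul_nonneg hν hκ)
  have h3 : c * ε ≤ c * P := mul_le_mul_of_nonneg_left hP hc.le
  nlinarith [h2, h3, hsmall]

/-- **Registered stub `stub_bridgePeriodicWitnesses` of line `Sketch` (crux `QuadratureStressFloor`,
stmt-AnomalousDissipation-18129): loud time-periodic classical drift witnesses imply the crux BY NAME.**
Hypothesis (inline, = the line's open core stub verbatim): some design `(F,V,m,n)`, `ν_j → 0⁺`,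
`τ_j`-periodic global classical solutions of `NS_{ν_j}` for `f = F sin(2πm x₁) cos(2πn x₂) e₀` with
`∫ u_j(0) = V e₂`, `meanEnergy ≤ E` and `ε ≤ meanDissipation` uniformly in `j`. Proof: periodic bookkeeping
(`stub_periodicDriftBookkeeping`: Leray–Hopf from `u_j 0`, sup-energy, no-leak with equality,
`Λ⟨(f,u_j)⟩ = meanDissipation` for every `Λ`), the landed identity `dopplerWorkIdentity_proof`
(`−Λ⟨T_s⟩ = (2πnV/F)Λ⟨(f,u)⟩ − νκ²Λ⟨(Ψ_s,u)⟩`), the uniform pairing bound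
`dopplerClock_abs_longTimeAvg_inner_le`, and the tail `j ↦ j + J` with `ε₀ = (2πnV/F)ε/2`
(Doering–Foias 2002 §2; FMRT 2001 Ch. IV §1). [folklore] -/
theorem stub_bridgePeriodicWitnesses :
    (∃ (F V : ℝ) (m n : ℕ), 0 < F ∧ 0 < V ∧ 0 < m ∧ 0 < n ∧
      ∃ (ν τ : ℕ → ℝ) (u : ℕ → ℝ → UnitAddTorus (Fin 3) → EuclideanSpace ℝ (Fin 3))
        (p : ℕ → ℝ → UnitAddTorus (Fin 3) → ℝ),
        (∀ j, 0 < ν j) ∧ Filter.Tendsto ν Filter.atTop (nhds 0) ∧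
        (∀ j, Literature.Analysis.FunctionSpaces.Torus.IsClassicalNSSolutionOn Set.univ (ν j)
            (fun _ => (fun (x : UnitAddTorus (Fin 3)) =>
              (F * (UnitAddTorus.mFourier (Pi.single (1 : Fin 3) (m : ℤ)) x).im *
                (UnitAddTorus.mFourier (Pi.single (2 : Fin 3) (n : ℤ)) x).re) •
                EuclideanSpace.single (0 : Fin 3) (1 : ℝ)))
            (u j) (p j) ∧ 0 < τ j ∧ Function.Periodic (u j) (τ j)) ∧
        (∀ j, ∫ x, u j 0 x = V • EuclideanSpace.single (2 : Fin 3) (1 : ℝ)) ∧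
        (∃ E : ℝ, ∀ j, Literature.Analysis.FluidPDE.meanEnergy (u j) ≤ E) ∧
        ∃ ε : ℝ, 0 < ε ∧ ∀ j, ε ≤ Literature.Analysis.FluidPDE.meanDissipation (ν j) (u j)) →
    Summit.AnomalousDissipation.AnomalousDissipation.Theses.DopplerClock.QuadratureStressFloor := by
  rintro ⟨F, V, m, n, hF, hV, hm, hn, ν, τ, u, p, hν, hν0, hsol, hmom, ⟨E, hE⟩, ε, hε, hfloor⟩
  obtain ⟨Λ⟩ := GeneralizedLimit.nonempty_holds
  -- abbreviations for the force and the quadrature pattern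
  set f : UnitAddTorus (Fin 3) → EuclideanSpace ℝ (Fin 3) := fun x =>
    (F * (UnitAddTorus.mFourier (Pi.single (1 : Fin 3) (m : ℤ)) x).im *
      (UnitAddTorus.mFourier (Pi.single (2 : Fin 3) (n : ℤ)) x).re) •
      EuclideanSpace.single (0 : Fin 3) (1 : ℝ) with hfdef
  set Ψ : UnitAddTorus (Fin 3) → EuclideanSpace ℝ (Fin 3) := fun y =>
    ((UnitAddTorus.mFourier (Pi.single (1 : Fin 3) (m : ℤ)) y).im *
      (UnitAddTorus.mFourier (Pi.single (2 : Fin 3) (n : ℤ)) y).im) •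
      EuclideanSpace.single (0 : Fin 3) (1 : ℝ) with hΨdef
  -- periodic bookkeeping for every member of the family
  have hbk : ∀ j, IsGlobalLerayHopf (ν j) (fun _ => f) (u j 0) (u j) ∧
      (∃ C : ℝ, ∀ t : ℝ, 0 ≤ t → kineticEnergy (u j t) ≤ C) ∧
      longTimeAvgSup (fun t => ∫ x, ⟪f x, u j t x⟫) = meanDissipation (ν j) (u j) ∧
      ∀ Λ' : GeneralizedLimit, Λ'.longTimeAvg (fun t => ∫ x, ⟪f x, u j t x⟫) =
        meanDissipation (ν j) (u j) :=
    fun j => stub_periodicDriftBookkeeping (ν j) (τ j) f (u j) (p j) (hν j) (hsol j).2.1 (hsol j).1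
      (hsol j).2.2
  have hLH : ∀ j, IsGlobalLerayHopf (ν j) (fun _ => f) (u j 0) (u j) := fun j => (hbk j).1
  have hsup : ∀ j, ∃ C : ℝ, ∀ t : ℝ, 0 ≤ t → kineticEnergy (u j t) ≤ C := fun j => (hbk j).2.1
  have hnoleak : ∀ j, longTimeAvgSup (fun t => ∫ x, ⟪f x, u j t x⟫) ≤ meanDissipation (ν j) (u j) :=
    fun j => ((hbk j).2.2.1).le
  have hinj : ∀ j, Λ.longTimeAvg (fun t => ∫ x, ⟪f x, u j t x⟫) = meanDissipation (ν j) (u j) :=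
    fun j => (hbk j).2.2.2 Λ
  -- uniform bound on the quadrature pairing `Λ⟨(Ψ_s, u_j)⟩`
  have hΨS : IsSmooth Ψ := dopplerClock_isSmooth_im_mul_im_smul _ _ _
  obtain ⟨K, hK0, hK⟩ := exists_nonneg_forall_norm_le_of_continuous hΨS.continuous
  set M : ℝ := K * (2⁻¹ * (1 + (E + 1))) with hMdef
  have hB : ∀ j, |Λ.longTimeAvg (fun t => ∫ x, ⟪Ψ x, u j t x⟫)| ≤ M := by
    intro j
    obtain ⟨C, hC⟩ := hsup j
    exact dopplerClock_abs_longTimeAvg_inner_le Λ (hLH j) hΨS.continuous hK0 hK hC (hE j)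
  have hM0 : 0 ≤ M := (abs_nonneg _).trans (hB 0)
  -- constants
  have hn' : (0 : ℝ) < (n : ℝ) := Nat.cast_pos.2 hn
  set κ2 : ℝ := (2 * Real.pi) ^ 2 * ((m : ℝ) ^ 2 + (n : ℝ) ^ 2) with hκ2def
  have hκ2 : 0 ≤ κ2 := by rw [hκ2def]; positivity
  set c : ℝ := V * (2 * Real.pi * n) / F with hcdef
  have hc : 0 < c := by rw [hcdef]; positivity
  -- the identity, solved for `−Λ⟨T_s⟩`
  have hid : ∀ j, -Λ.longTimeAvg (fun t => ∫ x, ⟪u j t x - V • EuclideanSpace.single (2 : Fin 3) (1 : ℝ),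
        convect (fun y => u j t y - V • EuclideanSpace.single (2 : Fin 3) (1 : ℝ)) Ψ x⟫) =
      c * meanDissipation (ν j) (u j) - ν j * κ2 * Λ.longTimeAvg (fun t => ∫ x, ⟪Ψ x, u j t x⟫) := by
    intro j
    have h := dopplerWorkIdentity_proof Λ F V (ν j) m n (u j 0) (u j) hV (hν j) hn (hLH j) (hmom j)
      (hsup j)
    rw [hinj j] at h
    have hFne : F ≠ 0 := hF.ne'
    have hVne : V * (2 * Real.pi * n) ≠ 0 := by positivity
    rw [hcdef]
    field_simp
    field_simp at h
    linarith
  -- choose the tail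
  obtain ⟨J, hJ⟩ : ∃ J : ℕ, ∀ j ≥ J, ν j ≤ c * ε / 2 / (κ2 * M + 1) := by
    have hpos : 0 < c * ε / 2 / (κ2 * M + 1) := by positivity
    exact eventually_atTop.1 ((hν0.eventually (ge_mem_nhds hpos)).mono fun j hj => hj)
  have hfloorTail : ∀ j, J ≤ j →
      c * ε / 2 ≤ -Λ.longTimeAvg (fun t => ∫ x, ⟪u j t x - V • EuclideanSpace.single (2 : Fin 3) (1 : ℝ),
        convect (fun y => u j t y - V • EuclideanSpace.single (2 : Fin 3) (1 : ℝ)) Ψ x⟫) := by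
    intro j hj
    have hsmall : ν j * (κ2 * M) ≤ c * ε / 2 := by
      have h1 : ν j * (κ2 * M + 1) ≤ c * ε / 2 := by
        have := hJ j hj
        rwa [le_div_iff₀ (by positivity)] at this
      nlinarith [(hν j).le, h1]
    exact periodicBridge_floor_tail_arith hc (hid j) (hfloor j) (hB j) (hν j).le hκ2 hsmall
  -- assemble the crux along the reindexed tail `j ↦ j + J`
  refine ⟨F, V, m, n, hF, hV, hm, hn, Λ, fun j => ν (j + J), fun j => u (j + J) 0, fun j => u (j + J),
    fun j => hν _, hν0.comp (tendsto_add_atTop_nat J), fun j => hLH _, fun j => hmom _, fun j => hsup _,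
    fun j => hnoleak _, c * ε / 2, by positivity, fun j => ?_⟩
  exact hfloorTail (j + J) (Nat.le_add_left J j)

end Summit.AnomalousDissipation.AnomalousDissipation.Theorems

end
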